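import Summits.SmoothPoincare4.SmoothPoincare4.Theorems.SymplecticOrigamiOrigamiFoldExistenceStubMorseFakeBall
import Summits.SmoothPoincare4.SmoothPoincare4.Theorems.SymplecticOrigamiOrigamiFoldExistenceStubKirbyFakeBallAux
import Literature.Topology.FourManifolds.HomotopySpheres
import Literature.Topology.FourManifolds.Morse
import Literature.Topology.FourManifolds.Handles
import Literature.Topology.FourManifolds.HandleAttachingMaps
import Literature.Topology.FourManifolds.RegularLevelSplitting
import Literature.Topology.FourManifolds.NiceMorseFunctionsProofs
import Literature.Topology.FourManifolds.MorseTurnAbout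
import HarnessLib

/-!
# Stub `stub_kirbyFakeBall` of line `bennequin-defect-certificates` for crux `OrigamiFoldExistence`
(item stmt-SmoothPoincare4-7844, route route-SmoothPoincare4-SymplecticOrigami)

The registered stub, VERBATIM: from a Morse function without critical points of index `1` on a
homotopy `4`-sphere `S`, a fake ball `Δ = S ∖ e(B̊⁴)` of `S` (typed extrinsically: `e : ℝ⁴ → S` and
`j : Δ → S` smooth embeddings, `range j = (e B̊⁴)ᶜ`, `j(∂Δ) = e(S³)`) PRESENTED as a Kirby diagram:
a compact orientable `1`-handlebody `W₀` (`IsHandlebodyOfIndexLE 3 1 W₀`, `IsOrientable (𝓡∂ 4) W₀`)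
with finitely many `2`-handles attached simultaneously
(`HandleAttachingMap.IsMultiAttachment h₀ (𝓡∂ 4) Δ`, Kosinski VI §6).

Proof (everything below is proved; no definitions, no named facts):

* The auxiliary file `…StubKirbyFakeBallAux.lean`, `helper_kirbyFakeBall_level` — **Kosinski's
  handle presentation theorem VII (2.2) / Cor. (1.2) on one critical level with several critical
  points**: if the critical points of a Morse function `f` adapted to the boundary of a compact `W`
  either have index `λ ≥ 1` and lie on one level `c < 1` or have index `≤ k` and value `≤ b < c`,
  then `W` is the compact manifold with boundary `W₀ = {f ≤ c - ε}` (a `k`-handlebody, orientable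
  if `W` is) with one `λ`-handle per critical point of the level attached simultaneously (the
  assembly of the tree's formalisation of VII (2.2), `SlabData.isMultiAttachment_slabSet`,
  `SlabData.isMultiAttachment_of_slabSet`, `SlabData.body_morseData`).
* §1 `exists_morseFakeBall_selfIndexing` — **the fake ball in self-indexed Morse form**: the
  given Morse function is rearranged into a self-indexing one `f₁` with the same critical points
  and indices (Milnor 1965, Thm. 4.8, the tree's theorem `exists_isSelfIndexing_criticalSet_eq_holds`),
  whose minimum `q` is its unique critical point of index `0` (no `1`-handles,
  `RoundTraceContinuity.subsingleton_criticalSetOfIndex_zero` of the landed `stub_morseFakeBall`);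
  the radially reparametrised Morse chart `e` at `q` has `e(B̊⁴) = {f₁ < c}`, `e(S³) = {f₁ = c}`,
  `c = R²/2 ≤ 1/2` (as in `stub_morseFakeBall`), and `g := c - f₁` is a Morse function with
  `{g ≤ 0} = S ∖ e(B̊⁴)`, `{g = 0} = e(S³)`, whose critical points in `{g ≤ 0}` have index
  `i ≤ 2` and value `c - 4 + i` (turning about, `IsMorse.morseIndex_const_sub_add`).
* §2 `stub_kirbyFakeBall` — `Δ := {g ≤ 0}` with its structure of compact manifold with boundary
  `{g = 0}` (`RegularSublevel`, Milnor 1963, Thm. 3.1; `j` = the inclusion, a smooth embedding;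
  orientable with `S`, `RegularSublevel.isOrientable`), the adapted Morse function `g|Δ + 1`
  (`RegularSublevel.morseData`: critical points of index `2` on the level `c - 1`, the others of
  index `≤ 1` below `c - 2`), and `helper_kirbyFakeBall_level` with `n = 3`, `λ = 2`, `k = 1`.

References: A. A. Kosinski, *Differential Manifolds* (1993), VI §6, VII (1.2), (2.2) [Kosinski1993];
J. Milnor, *Lectures on the h-cobordism theorem* (1965), Lemma 2.9, Thm. 4.8, proof of Thm. 9.1
[MilnorHCobordism1965]; J. Milnor, *Morse theory* (1963), Lemma 2.2, Thms. 3.1–3.2, 4.1 [Milnor1963].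
-/

noncomputable section

-- the prescribed namespace `Summit.<P>.<Sub>.…` duplicates `SmoothPoincare4` (P = Sub)
set_option linter.dupNamespace false

open scoped Manifold ContDiff Topology
open Set Function Metric Filter OpenPartialHomeomorph
open Literature.Topology.FourManifolds

namespace Summit.SmoothPoincare4.SmoothPoincare4.Theorems.OrigamiFoldExistence.BennequinDefectCertificates

/-! ### §1 The fake ball in self-indexed Morse form -/

section FakeBall

open RoundTraceContinuity

/-- `univBall 0 R` maps the unit sphere onto the sphere of radius `R/√2`:
`‖univBall 0 R y‖² = R²/2 ↔ ‖y‖ = 1`. [folklore] -/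
theorem norm_sq_univBall_eq_iff {E : Type*} [NormedAddCommGroup E] [NormedSpace ℝ E] {R : ℝ}
    (hR : 0 < R) (y : E) :
    ‖univBall (0 : E) R y‖ ^ 2 = R ^ 2 / 2 ↔ ‖y‖ = 1 := by
  rw [norm_sq_univBall_zero hR, div_eq_iff (by positivity : (1 + ‖y‖ ^ 2 : ℝ) ≠ 0)]
  have hR2 : 0 < R ^ 2 := by positivity
  have hy : 0 ≤ ‖y‖ := norm_nonneg y
  constructor
  · intro h
    have h1 : ‖y‖ ^ 2 = 1 := by nlinarith
    nlinarith
  · intro h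
    rw [h]; ring

/-- **The fake ball of a homotopy `4`-sphere in self-indexed Morse form.**  If `S` carries a Morse
function without critical points of index `1`, then there are a smooth embedding `e : ℝ⁴ → S`, a
Morse function `g` on `S` and a level `0 < c < 1` with `{g ≤ 0} = S ∖ e(B̊⁴)`, `{g = 0} = e(S³)`,
and such that every critical point `x` of `g` with `g x ≤ 0` has index `≤ 2` and value
`g x = c - 4 + index x`.  Proof: rearrange `f` into a self-indexing Morse function `f₁` with the
same critical points and indices (Milnor 1965, Thm. 4.8, `exists_isSelfIndexing_criticalSet_eq_holds`);
its minimum `q` is its only critical point of index `0` (no `1`-handles,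
`subsingleton_criticalSetOfIndex_zero`), so `f₁ q = 0` and the other critical values are the
indices `2, 3, 4`; take the radially reparametrised Morse chart `e` at `q` with
`e(B̊⁴) = {f₁ < c}`, `e(S³) = {f₁ = c}`, `c = R²/2 ≤ 1/2` (Milnor 1963, Lemma 2.2 and proof of
Thm. 4.1), and `g := c - f₁` (Milnor 1965, proof of Thm. 9.1: `index_g = 4 - index_{f₁}`).
[cite: MilnorHCobordism1965, Thm. 4.8 and proof of Thm. 9.1] -/
theorem exists_morseFakeBall_selfIndexing (S : HomotopySphere 4) {f : S.carrier → ℝ}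
    (hf : IsMorse (𝓡 4) f) (h1 : criticalSetOfIndex (𝓡 4) f 1 = ∅) :
    ∃ (e : EuclideanSpace ℝ (Fin 4) → S.carrier) (g : S.carrier → ℝ) (c : ℝ),
      Manifold.IsSmoothEmbedding (𝓡 4) (𝓡 4) ∞ e ∧ IsMorse (𝓡 4) g ∧ 0 < c ∧ c < 1 ∧
      {x | g x ≤ 0} = (e '' ball (0 : EuclideanSpace ℝ (Fin 4)) 1)ᶜ ∧
      {x | g x = 0} = e '' sphere (0 : EuclideanSpace ℝ (Fin 4)) 1 ∧
      ∀ x, IsMCriticalPt (𝓡 4) g x → g x ≤ 0 →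
        morseIndex (𝓡 4) g x ≤ 2 ∧ g x = c - 4 + morseIndex (𝓡 4) g x := by
  classical
  haveI : ConnectedSpace S.carrier := HomotopySphere.connectedSpace (by norm_num) S
  haveI : Nonempty S.carrier := HomotopySphere.nonempty S
  -- (a) self-indexing rearrangement, still without critical points of index `1`
  obtain ⟨f₁, hf₁, hsi, hcrit, hind⟩ := exists_isSelfIndexing_criticalSet_eq_holds 4 S.carrier f hf
  have h1' : criticalSetOfIndex (𝓡 4) f₁ 1 = ∅ := by rw [criticalSetOfIndex_congr hcrit hind 1, h1]
  have hcont : Continuous f₁ := hf₁.contMDiff.continuous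
  have hdiff : ∀ z, MDifferentiableAt (𝓡 4) 𝓘(ℝ, ℝ) f₁ z := fun z =>
    hf₁.contMDiff.mdifferentiableAt (by simp)
  -- (b) the unique critical point `q` of index `0`: the strict minimum, with `f₁ q = 0`
  have hsub0 : (criticalSetOfIndex (𝓡 4) f₁ 0).Subsingleton := subsingleton_criticalSetOfIndex_zero hf₁ h1'
  obtain ⟨q, -, hqmin⟩ := isCompact_univ.exists_isMinOn univ_nonempty hcont.continuousOn
  have hqle : ∀ x, f₁ q ≤ f₁ x := fun x => isMinOn_iff.1 hqmin x (mem_univ x)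
  have hqloc : IsLocalMin f₁ q := hqmin.isLocalMin univ_mem
  have hqc : IsMCriticalPt (𝓡 4) f₁ q := IsLocalMin.isMCriticalPt hqloc
  have hq0 : morseIndex (𝓡 4) f₁ q = 0 := hf₁.morseIndex_eq_zero_of_isLocalMin hqloc
  have hfq : f₁ q = 0 := by rw [hsi q hqc, hq0, Nat.cast_zero]
  have hstrict : ∀ x, x ≠ q → f₁ q < f₁ x := by
    intro x hx
    refine lt_of_le_of_ne (hqle x) fun heq => hx ?_
    have hxloc : IsLocalMin f₁ x :=
      Filter.Eventually.of_forall fun y => by rw [← heq]; exact hqle y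
    exact hsub0 ⟨IsLocalMin.isMCriticalPt hxloc, hf₁.morseIndex_eq_zero_of_isLocalMin hxloc⟩ ⟨hqc, hq0⟩
  -- the other critical points: index `2`, `3` or `4`, value `= index ≥ 2`
  have hother : ∀ x, IsMCriticalPt (𝓡 4) f₁ x → x ≠ q →
      2 ≤ morseIndex (𝓡 4) f₁ x ∧ morseIndex (𝓡 4) f₁ x ≤ 4 := by
    intro x hx hxq
    have hne0 : morseIndex (𝓡 4) f₁ x ≠ 0 := fun h0 => hxq (hsub0 ⟨hx, h0⟩ ⟨hqc, hq0⟩)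
    have hne1 : morseIndex (𝓡 4) f₁ x ≠ 1 := fun h1x => by
      have hx1 : x ∈ criticalSetOfIndex (𝓡 4) f₁ 1 := ⟨hx, h1x⟩
      rw [h1'] at hx1
      exact hx1
    have hle : morseIndex (𝓡 4) f₁ x ≤ 4 := by
      simpa using morseIndex_le_finrank (𝓡 4) f₁ x
    exact ⟨by omega, hle⟩
  -- (c) the Morse chart at `q`: `f₁ ∘ φ⁻¹ = ‖·‖²`, small sublevel sets are chart balls
  obtain ⟨φ, hφA, hqφ, hφq, hquad⟩ := IsMorse.exists_chart_eq_quadratic_holds hf₁ hqc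
  have hquad' : ∀ y ∈ φ.target, f₁ (φ.symm y) = f₁ q + ‖y‖ ^ 2 := by
    intro y hy
    rw [hquad y hy, hq0]
    have e1 : (Finset.univ.filter fun i : Fin 4 => i.val < 0) = ∅ := by ext i; simp
    have e2 : (Finset.univ.filter fun i : Fin 4 => 0 ≤ i.val) = Finset.univ := by ext i; simp
    rw [e1, e2, Finset.sum_empty, sub_zero, EuclideanSpace.real_norm_sq_eq]
  obtain ⟨ε₀, hε₀, H⟩ := exists_forall_sublevel_eq_image_closedBall hcont hstrict φ hqφ hφq hquad'
  -- (d) the radius `R ≤ min ε₀ 1` and the level `c = R²/2 ≤ 1/2`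
  obtain ⟨R, hRpos, hRε₀, hR1⟩ : ∃ R : ℝ, 0 < R ∧ R ≤ ε₀ ∧ R ≤ 1 :=
    ⟨min ε₀ 1, lt_min hε₀ one_pos, min_le_left _ _, min_le_right _ _⟩
  obtain ⟨hballR, hsubR⟩ := H R hRpos hRε₀
  have hballR' : ball (0 : EuclideanSpace ℝ (Fin 4)) R ⊆ φ.target := ball_subset_closedBall.trans hballR
  set c : ℝ := R ^ 2 / 2 with hc
  have hc0 : 0 < c := by positivity
  have hc1 : c < 1 := by rw [hc]; nlinarith
  -- the chart disc `e = φ⁻¹ ∘ univBall 0 R`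
  obtain ⟨e, he, heφ⟩ := exists_isSmoothEmbedding_comp_univBall hφA hRpos hballR'
  have huball : ∀ y, univBall (0 : EuclideanSpace ℝ (Fin 4)) R y ∈ ball (0 : EuclideanSpace ℝ (Fin 4)) R :=
    fun y => by
      rw [← univBall_target (0 : EuclideanSpace ℝ (Fin 4)) hRpos]
      exact (univBall (0 : EuclideanSpace ℝ (Fin 4)) R).map_source (by simp)
  -- points with `f₁ ≤ R²` are chart points `φ⁻¹ z`, `‖z‖ ≤ R`, with `f₁ = ‖z‖²`
  have hchart : ∀ x, f₁ x ≤ R ^ 2 → ∃ z, ‖z‖ ≤ R ∧ z ∈ φ.target ∧ φ.symm z = x ∧ f₁ x = ‖z‖ ^ 2 := by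
    intro x hx
    have hx' : x ∈ {x | f₁ x ≤ f₁ q + R ^ 2} := by simp only [mem_setOf_eq]; linarith
    rw [hsubR] at hx'
    obtain ⟨z, hz, rfl⟩ := hx'
    have hzR := mem_closedBall_zero_iff.1 hz
    refine ⟨z, hzR, hballR hz, rfl, ?_⟩
    rw [hquad' z (hballR hz), hfq, zero_add]
  -- a chart point of norm `< R` is `e y` with `‖univBall 0 R y‖ = ‖z‖`
  have hlift : ∀ z : EuclideanSpace ℝ (Fin 4), ‖z‖ < R →
      ∃ y, univBall (0 : EuclideanSpace ℝ (Fin 4)) R y = z ∧ e y = φ.symm z := by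
    intro z hz
    have hzt : z ∈ (univBall (0 : EuclideanSpace ℝ (Fin 4)) R).target := by
      rw [univBall_target (0 : EuclideanSpace ℝ (Fin 4)) hRpos]
      exact mem_ball_zero_iff.2 hz
    refine ⟨(univBall (0 : EuclideanSpace ℝ (Fin 4)) R).symm z,
      (univBall (0 : EuclideanSpace ℝ (Fin 4)) R).right_inv hzt, ?_⟩
    rw [heφ, (univBall (0 : EuclideanSpace ℝ (Fin 4)) R).right_inv hzt]
  -- the value of `f₁` at `e y`
  have hfe : ∀ y, f₁ (e y) = ‖univBall (0 : EuclideanSpace ℝ (Fin 4)) R y‖ ^ 2 := fun y => by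
    rw [heφ, hquad' _ (hballR' (huball y)), hfq, zero_add]
  -- the key identifications `{f₁ < c} = e(B̊⁴)` and `{f₁ = c} = e(S³)`
  have hkey : ∀ x, f₁ x < c ↔ x ∈ e '' ball (0 : EuclideanSpace ℝ (Fin 4)) 1 := by
    intro x
    constructor
    · intro hx
      obtain ⟨z, hzR, -, hzx, hfz⟩ := hchart x (by rw [hc] at hx; nlinarith)
      have hz2 : ‖z‖ ^ 2 < R ^ 2 / 2 := by rw [← hfz]; exact hx
      have hzR' : ‖z‖ < R := lt_of_pow_lt_pow_left₀ 2 hRpos.le (by nlinarith)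
      obtain ⟨y, hyz, hye⟩ := hlift z hzR'
      refine ⟨y, ?_, by rw [hye, hzx]⟩
      have h := norm_sq_univBall_lt_iff hRpos y
      rw [hyz] at h
      exact mem_ball_zero_iff.2 (h.1 hz2)
    · rintro ⟨y, hy, rfl⟩
      rw [hfe]
      exact (norm_sq_univBall_lt_iff hRpos y).2 (mem_ball_zero_iff.1 hy)
  have hsph : ∀ x, f₁ x = c ↔ x ∈ e '' sphere (0 : EuclideanSpace ℝ (Fin 4)) 1 := by
    intro x
    constructor
    · intro hx
      obtain ⟨z, hzR, -, hzx, hfz⟩ := hchart x (by rw [hx, hc]; nlinarith)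
      have hz2 : ‖z‖ ^ 2 = R ^ 2 / 2 := by rw [← hfz]; exact hx
      have hzR' : ‖z‖ < R := lt_of_pow_lt_pow_left₀ 2 hRpos.le (by nlinarith)
      obtain ⟨y, hyz, hye⟩ := hlift z hzR'
      refine ⟨y, ?_, by rw [hye, hzx]⟩
      have h := norm_sq_univBall_eq_iff hRpos y
      rw [hyz] at h
      exact mem_sphere_zero_iff_norm.2 (h.1 hz2)
    · rintro ⟨y, hy, rfl⟩
      rw [hfe]
      exact (norm_sq_univBall_eq_iff hRpos y).2 (mem_sphere_zero_iff_norm.1 hy)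
  -- (e) the turned-about function `g = c - f₁`
  refine ⟨e, fun x => c - f₁ x, c, he, hf₁.const_sub c, hc0, hc1, ?_, ?_, ?_⟩
  · ext x
    simp only [mem_setOf_eq, mem_compl_iff]
    exact sub_nonpos.trans (not_lt.symm.trans (not_congr (hkey x)))
  · ext x
    simp only [mem_setOf_eq]
    exact (sub_eq_zero.trans eq_comm).trans (hsph x)
  · intro x hxg hx
    have hx' : c ≤ f₁ x := by simpa only [sub_nonpos] using hx
    have hxf : IsMCriticalPt (𝓡 4) f₁ x := (isMCriticalPt_const_sub_iff _ (hdiff x)).1 hxg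
    have hxq : x ≠ q := by
      rintro rfl
      rw [hfq] at hx'
      exact absurd hx' (not_le.2 hc0)
    obtain ⟨h2, h4⟩ := hother x hxf hxq
    have hadd := hf₁.morseIndex_const_sub_add c hxf
    rw [finrank_euclideanSpace_fin] at hadd
    have hval : f₁ x = (morseIndex (𝓡 4) f₁ x : ℝ) := hsi x hxf
    refine ⟨by omega, ?_⟩
    have hcast : ((morseIndex (𝓡 4) (fun y => c - f₁ y) x : ℕ) : ℝ) + (morseIndex (𝓡 4) f₁ x : ℝ) = 4 := by
      exact_mod_cast hadd
    show c - f₁ x = c - 4 + (morseIndex (𝓡 4) (fun y => c - f₁ y) x : ℝ)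
    rw [hval]
    linarith

end FakeBall

/-! ### §2 The stub -/

/-- **Stub `stub_kirbyFakeBall` (Morse ⇒ Kirby-presented fake ball).**  If the homotopy `4`-sphere
`S` carries a Morse function without critical points of index `1`, then some fake ball
`Δ = S ∖ e(B̊⁴)` of `S` — `e : ℝ⁴ → S` and `j : Δ → S` smooth embeddings, `range j = (e B̊⁴)ᶜ`,
`j(∂Δ) = e(S³)` — is a compact orientable `1`-handlebody `W₀` with finitely many `2`-handles
attached simultaneously.  Proof: by `exists_morseFakeBall_selfIndexing`, `Δ = {g ≤ 0}` is a
regular sublevel set of a Morse function `g` on `S` (Milnor 1963, Thm. 3.1: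
`RegularSublevel`, boundary `{g = 0} = e(S³)`, orientable with `S`), on which `g + 1` is a Morse
function adapted to the boundary whose critical points of index `2` lie on the level `c - 1` and
whose other critical points have index `≤ 1` and value `≤ c - 2`; Kosinski's handle
presentation theorem on that level (`helper_kirbyFakeBall_level` of the auxiliary file: VII (2.2)
with Cor. (1.2)) presents `Δ` as `W₀ = {g + 1 ≤ c - 1 - ε}` — a compact orientable
`1`-handlebody — with one `2`-handle attached for each critical point of index `2`.
[cite: Kosinski1993, VII (2.2) and Cor. (1.2)] -/
theorem stub_kirbyFakeBall :
    ∀ S : Literature.Topology.FourManifolds.HomotopySphere 4,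
      (∃ f : S.carrier → ℝ, Literature.Topology.FourManifolds.IsMorse (𝓡 4) f ∧
          Literature.Topology.FourManifolds.criticalSetOfIndex (𝓡 4) f 1 = ∅) →
      ∃ (e : EuclideanSpace ℝ (Fin 4) → S.carrier) (Δ : Type) (_ : TopologicalSpace Δ) (_ : T2Space Δ)
        (_ : SecondCountableTopology Δ) (_ : ChartedSpace (EuclideanHalfSpace 4) Δ)
        (_ : IsManifold (𝓡∂ 4) ∞ Δ) (_ : CompactSpace Δ) (j : Δ → S.carrier)
        (W₀ : Type) (_ : TopologicalSpace W₀) (_ : T2Space W₀) (_ : SecondCountableTopology W₀)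
        (_ : ChartedSpace (EuclideanHalfSpace 4) W₀) (_ : IsManifold (𝓡∂ 4) ∞ W₀) (_ : CompactSpace W₀)
        (ι : Type) (_ : Finite ι) (h₀ : ι → Literature.Topology.FourManifolds.HandleAttachingMap 3 2 W₀),
        (Manifold.IsSmoothEmbedding (𝓡 4) (𝓡 4) ∞ e ∧ Manifold.IsSmoothEmbedding (𝓡∂ 4) (𝓡 4) ∞ j ∧
          Set.range j = (e '' Metric.ball (0 : EuclideanSpace ℝ (Fin 4)) 1)ᶜ ∧
          j '' ((𝓡∂ 4).boundary Δ) = e '' Metric.sphere (0 : EuclideanSpace ℝ (Fin 4)) 1) ∧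
        Literature.Topology.FourManifolds.IsOrientable (𝓡∂ 4) W₀ ∧
        Literature.Topology.FourManifolds.IsHandlebodyOfIndexLE 3 1 W₀ ∧
        Literature.Topology.FourManifolds.HandleAttachingMap.IsMultiAttachment h₀ (𝓡∂ 4) Δ := by
  intro S hS
  obtain ⟨f, hf, h1⟩ := hS
  obtain ⟨e, g, c, he, hg, hc0, hc1, hle, heq, hval⟩ := exists_morseFakeBall_selfIndexing S hf h1
  -- `0` is a regular level of `g`: the critical values of `g` in `{g ≤ 0}` are `≤ c - 2 < 0`
  have hreg : IsRegularLevel (𝓡 4) g 0 := hg.isRegularLevel fun z hz h0 => by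
    obtain ⟨hidx, hgz⟩ := hval z hz h0.le
    have hidx' : (morseIndex (𝓡 4) g z : ℝ) ≤ 2 := by exact_mod_cast hidx
    rw [h0] at hgz
    linarith
  -- the fake ball `Δ = {g ≤ 0}` as a compact manifold with boundary `{g = 0}`
  have hor : IsOrientable (𝓡∂ 4) (RegularSublevel hreg) :=
    RegularSublevel.isOrientable hreg ⟨S.orientation⟩
  obtain ⟨hF, hFcrit, hFidx⟩ := RegularSublevel.morseData hg hreg
  -- the critical points of `g + 1` on `Δ`: index `2` on the level `c - 1`, index `≤ 1` below `c - 2`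
  have hvalF : ∀ z : RegularSublevel hreg,
      IsMCriticalPt (𝓡∂ 4) (fun x : RegularSublevel hreg => g (RegularSublevel.incl hreg x) + (1 - 0)) z →
      (morseIndex (𝓡∂ 4) (fun x : RegularSublevel hreg => g (RegularSublevel.incl hreg x) + (1 - 0)) z = 2 ∧
          g (RegularSublevel.incl hreg z) + (1 - 0) = c - 1) ∨
      (morseIndex (𝓡∂ 4) (fun x : RegularSublevel hreg => g (RegularSublevel.incl hreg x) + (1 - 0)) z ≤ 1 ∧
          g (RegularSublevel.incl hreg z) + (1 - 0) ≤ c - 2) := by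
    intro z hz
    have hz' : IsMCriticalPt (𝓡 4) g (RegularSublevel.incl hreg z) := (hFcrit z).1 hz
    obtain ⟨hidx, hgz⟩ := hval _ hz' (RegularSublevel.apply_incl_le hreg z)
    have hidxF : morseIndex (𝓡∂ 4)
        (fun x : RegularSublevel hreg => g (RegularSublevel.incl hreg x) + (1 - 0)) z =
        morseIndex (𝓡 4) g (RegularSublevel.incl hreg z) := hFidx z hz'
    rw [hidxF]
    rcases Nat.lt_or_ge (morseIndex (𝓡 4) g (RegularSublevel.incl hreg z)) 2 with hlt | hge
    · right
      refine ⟨by omega, ?_⟩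
      have : (morseIndex (𝓡 4) g (RegularSublevel.incl hreg z) : ℝ) ≤ 1 := by
        exact_mod_cast Nat.lt_succ_iff.1 hlt
      linarith
    · left
      have h2 : morseIndex (𝓡 4) g (RegularSublevel.incl hreg z) = 2 := le_antisymm hidx hge
      refine ⟨h2, ?_⟩
      rw [h2] at hgz
      push_cast at hgz
      linarith
  -- Kosinski's handle presentation theorem on the level `c - 1`
  obtain ⟨W₀, _i1, _i2, _i3, _i4, _i5, _i6, ι, _i7, h₀, hW₀or, hW₀hb, hatt⟩ :=
    helper_kirbyFakeBall_level 3 (by norm_num) (RegularSublevel hreg) _ hF 2 1 (by norm_num)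
      (c - 2) (c - 1) (by linarith) (by linarith) hvalF hor
  refine ⟨e, RegularSublevel hreg, inferInstance, inferInstance, inferInstance, inferInstance,
    inferInstance, inferInstance, RegularSublevel.incl hreg, W₀, _i1, _i2, _i3, _i4, _i5, _i6, ι, _i7,
    h₀, ⟨he, RegularSublevel.isSmoothEmbedding_incl hreg, ?_, ?_⟩, hW₀or, hW₀hb, hatt⟩
  · -- `range j = {g ≤ 0} = (e B̊⁴)ᶜ`
    rw [RegularSublevel.range_incl, ← hle]
    rfl
  · -- `j(∂Δ) = {g = 0} = e(S³)`
    rw [← heq]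
    ext x
    constructor
    · rintro ⟨p, hp, rfl⟩
      exact (RegularSublevel.mem_boundary_iff hreg p).1 hp
    · intro hx
      have hx0 : g x = 0 := hx
      exact ⟨RegularSublevel.mk hreg x hx0.le, (RegularSublevel.mem_boundary_iff hreg _).2 hx0, rfl⟩

end Summit.SmoothPoincare4.SmoothPoincare4.Theorems.OrigamiFoldExistence.BennequinDefectCertificates

end
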